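/-
Copyright (c) 2026. All rights reserved.
Released under Apache 2.0 license as described in the file LICENSE.
-/
import Literature.AlgebraicGeometry.ComplexMultiplication.HyperellipticJacobianLevelTwenty
import HarnessLib

/-!
# The imaginary quadratic reflex fields `ℚ(√−2) = K*(Φ_8)`, `ℚ(√−3) ⊂ K*(Φ_{3k})`, `ℚ(√−5) = K*(Φ_{20})`, `ℚ(√−6) = K*(Φ_{24})`
# are pairwise distinct: `Y_8 ⟂ Y_{20}, Y_{24}`; `Y_{20} ⟂ Y_{24}`; `X_3, X_6 ⟂ Y_{24}`; `X_3, X_6 ⟂ Y_{60}` (degrees)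

Layer `Literature/AlgebraicGeometry/ComplexMultiplication`, namespace `…ComplexMultiplication.HyperellipticJacobian`; the sequel of
`HyperellipticJacobianCrossLevelOrthogonality` (F12: the reflex field `K*(Φ) ⊂ ℂ` is a `Hom`-invariant) and `HyperellipticJacobianLevelTwenty`
(F16: `i ∉ ℚ(√−5), ℚ(√−6)`).  THEOREMS ONLY (no definition, no named fact, no `sorry`, no instance).

## The print

A. Gallese, H. Goodson, D. Lombardo, arXiv:2405.20394 [GalleseGoodsonLombardo2024] (held `paper:arxiv-2405.20394`, p0012–p0015): THM. 3.0, last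
statement «all `X_d` with odd `d` and all `Y_d` are pairwise non-isogenous»; §3.2 LEMMA 12 (`K₁ = ℚ(ζ_d − ζ_d^{−1})`, so `K*(Φ_8) = ℚ(ζ_8 − ζ_8^{−1})
= ℚ(√−2)`); §3.4 («`ℚ(√−5)` is the CM field of … `Y_{20}`», «the CM field of `Y_{24}` is `ℚ(√−6)`», `F_{60}` of degree `4`).  The factors are
separated here by ELEMENTS OF GIVEN SQUARE in the reflex fields read in `ℂ` (a `Hom`-invariant, F12 §0): `y² = −k` is soluble in `ℚ(√−n)`
iff `nk` is a square.

## What is proved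

* §1 (private) `sq_ne_neg_of_mem_adjoin`: for `w ∈ ℂ`, `w² = −n`, and `k ≥ 1` with `nk` not a square, no `y ∈ ℚ(w)` has `y² = −k`.
* §2 `traceField_eight` (`K*(Φ_8) = ℚ(x ζ − (x ζ)⁻¹)`, `(x ζ − (x ζ)⁻¹)² = −2`, degree `2`); `exists_sq_eq_neg_three_mem_traceField_odd ∕ _twiceOdd`
  (`3 ∣ d`: `(2ω + 1)² = −3`); `sq_ne_neg_of_mem_traceField_eight ∕ _twenty ∕ _twentyFour` (`y² ≠ −k` when `2k`, `5k`, `6k` is not a square).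
* §3 **`orthogonal_eight_twenty`**, **`orthogonal_eight_twentyFour`**, **`orthogonal_twenty_twentyFour`**, **`orthogonal_odd_twentyFour_of_three_dvd`**
  (so `X_3 ⟂ Y_{24}`), `orthogonal_twiceOdd_twentyFour_of_three_dvd` (`X_6 ⟂ Y_{24}`), `orthogonal_twiceOdd_twentyFour_of_totient_ne_two`,
  `orthogonal_odd_sixty_of_totient_ne_four` (so `X_3 ⟂ Y_{60}`), `orthogonal_twiceOdd_sixty_of_totient_ne_four` — each: `Hom = 0` both ways
  and non-isogenous, for ALL realisations of the lower-half types.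

## Honest column ∕ NOT here

The curve; `X_5, X_{10}` vs `Y_{60}` (equal reflex degree `4`: needs the stabiliser `{1, 11, 19, 29}` of `Φ_{60}`) and `Y_d` vs `Y_{d′}` with
`φ(d) = φ(d′)`, `d ≡ d′ (mod 8)` (conductor theory) remain untyped.  `HC_CM` is not touched.

## References

* [GalleseGoodsonLombardo2024] arXiv:2405.20394 — §3 Thm. 3.0 (last statement), §3.2 Lemma 12, §3.4.
* [Shimura1998] G. Shimura — §8.3 Prop. 28, §8.4 Example (1).
* [MilneCM2006] J. S. Milne — Ch. I §1 Prop. 1.18 (c), §3 Prop. 3.13.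

## Provenance

Cell `pub-hodgecm2` (COR-CM), KEPT Literature lane `lit-deligne-3` gen 51 (claim GGL24-QUADRATIC-REFLEX-SEPARATION; count-neutral, own lane).
-/

noncomputable section

open CategoryTheory CategoryTheory.Limits NumberField Module Polynomial

namespace Literature.AlgebraicGeometry.ComplexMultiplication

open Literature.AlgebraicGeometry.Motives
open Literature.AlgebraicGeometry.HodgeTheory (complexBetti)
open Literature.NumberTheory.ComplexMultiplication

namespace HyperellipticJacobian

open Literature.AlgebraicGeometry.Pohlmann1968 Literature.AlgebraicGeometry.Pohlmann1968.Cyclotomic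

/-! ## §1 `y² = −k` in `ℚ(√−n)` forces `nk` to be a square -/

section SqrtNeg

/-- For `w ∈ ℂ` with `w² = −n` (`n ∈ ℕ`) and `k ≥ 1` with `nk` NOT a square, no element of `ℚ(w) ⊂ ℂ` squares to `−k`: writing
`y = a + b·w` on the power basis, `y² = −k` gives `(a² − n b² + k) + 2ab·w = 0`; `2ab = 0` forces `a² = −k` or `n b² = k` (`nk = (nb)²`),
and `2ab ≠ 0` forces `−n (2ab)² = (a² − n b² + k)²`, i.e. `n = 0`. [folklore] -/
private theorem sq_ne_neg_of_mem_adjoin {w : ℂ} {n k : ℕ} (hw : w ^ 2 = -(n : ℂ)) (hk : 0 < k) (hnk : ¬ IsSquare (n * k)) {y : ℂ}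
    (hy : y ∈ IntermediateField.adjoin ℚ {w}) : y ^ 2 ≠ -(k : ℂ) := by
  intro hy2
  have hroot : aeval w (X ^ 2 + C (n : ℚ) : ℚ[X]) = 0 := by
    simp [hw]
  have hint : IsIntegral ℚ w := ⟨X ^ 2 + C (n : ℚ), monic_X_pow_add_C _ two_ne_zero, by simpa using hroot⟩
  let pb := IntermediateField.adjoin.powerBasis hint
  have hdim : pb.dim ≤ 2 := by
    have h := minpoly.degree_le_of_ne_zero (A := ℚ) (x := w) (p := X ^ 2 + C (n : ℚ))
      (Monic.ne_zero (monic_X_pow_add_C _ two_ne_zero)) hroot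
    rw [degree_X_pow_add_C two_pos] at h
    have h' : (minpoly ℚ w).natDegree ≤ 2 := natDegree_le_iff_degree_le.2 h
    simpa [pb] using h'
  obtain ⟨f, hf, hyf⟩ := pb.exists_eq_aeval ⟨y, hy⟩
  have hf1 : f.natDegree ≤ 1 := by omega
  set a : ℚ := f.coeff 0 with ha
  set b : ℚ := f.coeff 1 with hb
  have hyab : y = (a : ℂ) + (b : ℂ) * w := by
    have h := congrArg (fun z : IntermediateField.adjoin ℚ {w} => (z : ℂ)) hyf
    simp only at h
    rw [eq_X_add_C_of_natDegree_le_one hf1] at h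
    rw [h]
    simp [pb, map_add, map_mul, aeval_C, aeval_X, ← ha, ← hb]
    ring
  have hrel : ((a ^ 2 - n * b ^ 2 + k : ℚ) : ℂ) + ((2 * a * b : ℚ) : ℂ) * w = 0 := by
    have h1 : ((a : ℂ) + (b : ℂ) * w) ^ 2 = -(k : ℂ) := by rw [← hyab]; exact hy2
    push_cast
    linear_combination h1 - (b : ℂ) ^ 2 * hw
  have hk' : (0 : ℚ) < k := by exact_mod_cast hk
  by_cases hB : (2 * a * b : ℚ) = 0
  · have hA : (a ^ 2 - n * b ^ 2 + k : ℚ) = 0 := by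
      rw [hB] at hrel
      push_cast at hrel
      have h : ((a ^ 2 - n * b ^ 2 + k : ℚ) : ℂ) = 0 := by push_cast; linear_combination hrel
      exact_mod_cast h
    rcases mul_eq_zero.1 hB with hab | hb0
    · rcases mul_eq_zero.1 hab with h2 | ha0
      · norm_num at h2
      · -- `a = 0`: `n b² = k`, so `nk = (n b)²`
        rw [ha0] at hA
        have hnb : (n : ℚ) * b ^ 2 = k := by linarith
        have hsq : IsSquare ((n * k : ℕ) : ℚ) := ⟨n * b, by push_cast; linear_combination (-(n : ℚ)) * hnb⟩
        exact hnk (Rat.isSquare_natCast_iff.1 hsq)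
    · -- `b = 0`: `a² = −k`
      rw [hb0] at hA
      nlinarith [sq_nonneg a]
  · have hBw : ((2 * a * b : ℚ) : ℂ) * w = -((a ^ 2 - n * b ^ 2 + k : ℚ) : ℂ) := by linear_combination hrel
    have hsqC : ((2 * a * b : ℚ) : ℂ) ^ 2 * w ^ 2 = ((a ^ 2 - n * b ^ 2 + k : ℚ) : ℂ) ^ 2 := by
      rw [← mul_pow, hBw, neg_sq]
    rw [hw] at hsqC
    have hsqQ : (2 * a * b : ℚ) ^ 2 * (-(n : ℚ)) = (a ^ 2 - n * b ^ 2 + k : ℚ) ^ 2 := by exact_mod_cast hsqC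
    have hB2 : 0 < (2 * a * b : ℚ) ^ 2 := by positivity
    have hn0 : (n : ℚ) ≤ 0 := by nlinarith [sq_nonneg (a ^ 2 - n * b ^ 2 + k : ℚ)]
    have hn0' : n = 0 := by exact_mod_cast le_antisymm hn0 (Nat.cast_nonneg n)
    exact hnk ⟨0, by rw [hn0', zero_mul, mul_zero]⟩

/-- `¬ IsSquare N` for the small non-squares used below (`10, 12, 18, 30`). [folklore] -/
private theorem not_isSquare_of_lt {N t : ℕ} (hlo : t * t < N) (hhi : N < (t + 1) * (t + 1)) : ¬ IsSquare N := by
  rintro ⟨s, hs⟩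
  rcases Nat.lt_or_ge t s with h | h
  · have : (t + 1) * (t + 1) ≤ s * s := Nat.mul_le_mul h h
    omega
  · have : s * s ≤ t * t := Nat.mul_le_mul h h
    omega

/-- For a primitive `8`-th root of unity `z ∈ ℂ`: `(z − z⁻¹)² = −2` (`z⁴ = −1`, so `z² + z⁻² = 0`). [folklore] -/
private theorem sq_sub_inv_eq_neg_two {z : ℂ} (hz : IsPrimitiveRoot z 8) : (z - z⁻¹) ^ 2 = -2 := by
  have hz0 : z ≠ 0 := hz.ne_zero (by norm_num)
  have h8 : z ^ 8 = 1 := hz.pow_eq_one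
  have h4 : z ^ 4 = -1 := by
    have h : (z ^ 4) ^ 2 = 1 := by rw [← pow_mul]; exact h8
    rcases sq_eq_one_iff.1 h with h' | h'
    · exact absurd h' (hz.pow_ne_one_of_pos_of_lt (by norm_num) (by norm_num))
    · exact h'
  have h7 : z * z ^ 7 = 1 := by rw [← pow_succ']; exact h8
  have hinv : z⁻¹ = z ^ 7 := inv_eq_of_mul_eq_one_right h7
  rw [hinv]
  linear_combination (-2 + z ^ 6) * h8 + z ^ 2 * h4

/-- For a primitive cube root of unity `ω ∈ ℂ`: `(2ω + 1)² = −3`. [folklore] -/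
private theorem sq_two_mul_add_one_eq_neg_three {ω : ℂ} (hω : IsPrimitiveRoot ω 3) : (2 * ω + 1) ^ 2 = -3 := by
  have h := hω.geom_sum_eq_zero (by norm_num : 1 < 3)
  simp only [Finset.sum_range_succ, Finset.sum_range_zero, pow_zero, pow_one, zero_add] at h
  linear_combination 4 * h

end SqrtNeg

/-! ## §2 Elements of given square in the reflex fields -/

section Elements

variable {K : Type} [Field K] [NumberField K]

/-- **`K*(Φ_8) = ℚ(x ζ − (x ζ)⁻¹) = ℚ(√−2)`**: the reflex field of the lower-half type at level `8` is generated over `ℚ` by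
`w = x(ζ_8) − x(ζ_8)⁻¹`, `w² = −2`, and has degree `2` (GGL Lemma 12: `K₁ = ℚ(ζ − ζ^{−1})`, `X_8 ∼ Y_8²`).
[cite: GalleseGoodsonLombardo2024, §3.2 Lemma 12 and §3 Thm. 3.0 (5)] [cite: Shimura1998, §8.4 Example (1) (p. 85)] -/
theorem traceField_eight [IsCyclotomicExtension {8} ℚ K] (Φ : CMType K) (hΦ : ∀ σ : K →+* ℂ, σ ∈ Φ.1 ↔ 2 * (expOf 8 K σ).val < 8)
    (x : K →+* ℂ) :
    traceField Φ = IntermediateField.adjoin ℚ {x (zetaOf 8 K) - (x (zetaOf 8 K))⁻¹} ∧ (x (zetaOf 8 K) - (x (zetaOf 8 K))⁻¹) ^ 2 = -2 ∧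
      finrank ℚ (traceField Φ) = 2 := by
  haveI : NeZero (8 : ℕ) := ⟨by norm_num⟩
  refine ⟨traceField_eq_adjoin_of_four_dvd ⟨2, rfl⟩ le_rfl (by norm_num) (by norm_num) (by norm_num) Φ hΦ x,
    sq_sub_inv_eq_neg_two ((IsCyclotomicExtension.zeta_spec 8 ℚ K).map_of_injective x.injective), ?_⟩
  have h := two_mul_finrank_traceField_of_four_dvd ⟨2, rfl⟩ le_rfl (by norm_num) (by norm_num) (by norm_num) Φ hΦ
  have h8 : Nat.totient 8 = 4 := by decide +kernel
  rw [h8] at h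
  omega

/-- **`√−3 ∈ K*(Φ_d)` for odd `d` with `3 ∣ d`**: the reflex field `x(ℚ(ζ_d))` contains `2ω + 1`, `ω = x(ζ_d)^{d/3}`, of square `−3`.
[cite: GalleseGoodsonLombardo2024, §3.5 Prop. 13 (proof: «the reflex field is ℚ(ζ_d)»)] [cite: Shimura1998, §8.4 Example (1)] -/
theorem exists_sq_eq_neg_three_mem_traceField_odd {d : ℕ} [NeZero d] [IsCyclotomicExtension {d} ℚ K] (hd : Odd d) (h3 : 3 ∣ d)
    (Φ : CMType K) (hΦ : ∀ σ : K →+* ℂ, σ ∈ Φ.1 ↔ 2 * (expOf d K σ).val < d) : ∃ u ∈ traceField Φ, u ^ 2 = -3 := by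
  obtain ⟨y, hy, hyd⟩ := exists_isPrimitiveRoot_mem_traceField_odd hd Φ hΦ
  have hd0 : d / 3 ≠ 0 := by
    obtain ⟨e, rfl⟩ := h3
    have : e ≠ 0 := by rintro rfl; exact NeZero.ne (3 * 0) rfl
    simpa using this
  have hω : IsPrimitiveRoot (y ^ (d / 3)) 3 := by
    have h := hyd.pow_of_dvd hd0 (Nat.div_dvd_of_dvd h3)
    rwa [Nat.div_div_self h3 (NeZero.ne d)] at h
  exact ⟨2 * y ^ (d / 3) + 1, add_mem (mul_mem (by exact_mod_cast (traceField Φ).natCast_mem 2) (pow_mem hy _)) (one_mem _),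
    sq_two_mul_add_one_eq_neg_three hω⟩

/-- **`√−3 ∈ K*(Φ_{2n})` for odd `n ≥ 3` with `3 ∣ n`** (`K*(Φ_{2n}) = x(ℚ(ζ_{2n})) ∋` a primitive `n`-th root of unity).
[cite: GalleseGoodsonLombardo2024, §3.5 Prop. 13 (proof) and §3 Thm. 3.0 (4)] [cite: Shimura1998, §8.4 Example (1)] -/
theorem exists_sq_eq_neg_three_mem_traceField_twiceOdd {n : ℕ} [NeZero (2 * n)] {L : Type} [Field L] [NumberField L]
    [IsCyclotomicExtension {2 * n} ℚ L] (hn : Odd n) (h3n : 3 ≤ n) (h3 : 3 ∣ n) (Ψ : CMType L)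
    (hΨ : ∀ σ : L →+* ℂ, σ ∈ Ψ.1 ↔ 2 * (expOf (2 * n) L σ).val < 2 * n) : ∃ u ∈ traceField Ψ, u ^ 2 = -3 := by
  haveI : NeZero n := ⟨by omega⟩
  obtain ⟨y, hy, hyn⟩ := exists_isPrimitiveRoot_mem_traceField_twiceOdd hn h3n Ψ hΨ
  have hn0 : n / 3 ≠ 0 := by
    intro h
    have := Nat.lt_of_div_eq_zero (by norm_num) h
    omega
  have hω : IsPrimitiveRoot (y ^ (n / 3)) 3 := by
    have h := hyn.pow_of_dvd hn0 (Nat.div_dvd_of_dvd h3)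
    rwa [Nat.div_div_self h3 (by omega)] at h
  exact ⟨2 * y ^ (n / 3) + 1, add_mem (mul_mem (by exact_mod_cast (traceField Ψ).natCast_mem 2) (pow_mem hy _)) (one_mem _),
    sq_two_mul_add_one_eq_neg_three hω⟩

/-- **No `y ∈ K*(Φ_8) = ℚ(√−2)` has `y² = −k` when `2k` is not a square** (e.g. `k = 5, 6, 3, 1`…: `k = 1` excluded only if `2` — never a square).
[cite: GalleseGoodsonLombardo2024, §3.2 Lemma 12] [cite: Shimura1998, §8.3 Prop. 28] -/
theorem sq_ne_neg_of_mem_traceField_eight [IsCyclotomicExtension {8} ℚ K] (Φ : CMType K)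
    (hΦ : ∀ σ : K →+* ℂ, σ ∈ Φ.1 ↔ 2 * (expOf 8 K σ).val < 8) {k : ℕ} (hk : 0 < k) (h2k : ¬ IsSquare (2 * k)) {y : ℂ}
    (hy : y ∈ traceField Φ) : y ^ 2 ≠ -(k : ℂ) := by
  obtain ⟨x⟩ := (inferInstance : Nonempty (K →+* ℂ))
  obtain ⟨htr, hsq, -⟩ := traceField_eight Φ hΦ x
  rw [htr] at hy
  have hw : (x (zetaOf 8 K) - (x (zetaOf 8 K))⁻¹) ^ 2 = -((2 : ℕ) : ℂ) := by rw [hsq]; norm_num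
  exact sq_ne_neg_of_mem_adjoin hw hk h2k hy

/-- **No `y ∈ K*(Φ_{20}) = ℚ(√−5)` has `y² = −k` when `5k` is not a square** (`k = 2, 3, 6, 1`).
[cite: GalleseGoodsonLombardo2024, §3.4] [cite: Shimura1998, §8.3 Prop. 28] -/
theorem sq_ne_neg_of_mem_traceField_twenty [IsCyclotomicExtension {20} ℚ K] (Φ : CMType K)
    (hΦ : ∀ σ : K →+* ℂ, σ ∈ Φ.1 ↔ 2 * (expOf 20 K σ).val < 20) {k : ℕ} (hk : 0 < k) (h5k : ¬ IsSquare (5 * k)) {y : ℂ}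
    (hy : y ∈ traceField Φ) : y ^ 2 ≠ -(k : ℂ) := by
  obtain ⟨x⟩ := (inferInstance : Nonempty (K →+* ℂ))
  obtain ⟨htr, hsq, -, -⟩ := traceField_twenty Φ hΦ x
  rw [htr] at hy
  have hw : (x (zetaOf 20 K + zetaOf 20 K ^ 3 + zetaOf 20 K ^ 7 + zetaOf 20 K ^ 9)) ^ 2 = -((5 : ℕ) : ℂ) := by
    rw [hsq]; norm_num
  exact sq_ne_neg_of_mem_adjoin hw hk h5k hy

/-- **No `y ∈ K*(Φ_{24}) = ℚ(√−6)` has `y² = −k` when `6k` is not a square** (`k = 2, 3, 5, 1`).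
[cite: GalleseGoodsonLombardo2024, §3.4] [cite: Shimura1998, §8.3 Prop. 28] -/
theorem sq_ne_neg_of_mem_traceField_twentyFour [IsCyclotomicExtension {24} ℚ K] (Φ : CMType K)
    (hΦ : ∀ σ : K →+* ℂ, σ ∈ Φ.1 ↔ 2 * (expOf 24 K σ).val < 24) {k : ℕ} (hk : 0 < k) (h6k : ¬ IsSquare (6 * k)) {y : ℂ}
    (hy : y ∈ traceField Φ) : y ^ 2 ≠ -(k : ℂ) := by
  obtain ⟨x⟩ := (inferInstance : Nonempty (K →+* ℂ))
  obtain ⟨htr, hsq, -, -⟩ := traceField_twentyFour Φ hΦ x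
  rw [htr] at hy
  have hw : (x (zetaOf 24 K + zetaOf 24 K ^ 5 + zetaOf 24 K ^ 7 + zetaOf 24 K ^ 11)) ^ 2 = -((6 : ℕ) : ℂ) := by
    rw [hsq]; norm_num
  exact sq_ne_neg_of_mem_adjoin hw hk h6k hy

end Elements

/-! ## §3 Orthogonality of the factors with imaginary quadratic reflex fields -/

section Orthogonal

variable {K : Type} [Field K] [NumberField K] {Φ : CMType K}
  {A : AbelianVariety ℂ} {ι : 𝓞 K →+* End A} {θ : K →+* Module.End ℂ (complexBetti A.X 1)}
  {K' : Type} [Field K'] [NumberField K'] {Φ' : CMType K'}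
  {A' : AbelianVariety ℂ} {ι' : 𝓞 K' →+* End A'} {θ' : K' →+* Module.End ℂ (complexBetti A'.X 1)}
  {n : ℕ} [NeZero (2 * n)] {L : Type} [Field L] [NumberField L] [IsCyclotomicExtension {2 * n} ℚ L] {Ψ : CMType L}
  {B : AbelianVariety ℂ} {ιB : 𝓞 L →+* End B} {θB : L →+* Module.End ℂ (complexBetti B.X 1)}
  {d : ℕ} [NeZero d]

/-- **`Y_8 ⟂ Y_{20}`** (`ℚ(√−2) ≠ ℚ(√−5)`: `K*(Φ_8) ∋ w`, `w² = −2`; `10` is not a square): `Hom = 0` both ways, not isogenous, for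
all realisations of the lower-half types at levels `8` and `20`. [cite: GalleseGoodsonLombardo2024, §3 Thm. 3.0 (last statement), §3.2 Lemma 12, §3.4]
[cite: MilneCM2006, Ch. I §1 Prop. 1.18 (c) and §3 Prop. 3.13] -/
theorem orthogonal_eight_twenty [IsCyclotomicExtension {8} ℚ K] [IsCyclotomicExtension {20} ℚ K']
    (hΦ : ∀ σ : K →+* ℂ, σ ∈ Φ.1 ↔ 2 * (expOf 8 K σ).val < 8) (hA : IsCMTypeRealisation Φ A ι θ)
    (hΦ' : ∀ σ : K' →+* ℂ, σ ∈ Φ'.1 ↔ 2 * (expOf 20 K' σ).val < 20) (hA' : IsCMTypeRealisation Φ' A' ι' θ') :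
    (∀ u : A ⟶ A', u = 0) ∧ (∀ v : A' ⟶ A, v = 0) ∧
      ¬ AbelianVariety.IsIsogenous A A' ∧ ¬ AbelianVariety.IsIsogenous A' A := by
  refine hA.orthogonal_of_traceField_ne hA' fun heq => ?_
  obtain ⟨x⟩ := (inferInstance : Nonempty (K →+* ℂ))
  obtain ⟨htr, hsq, -⟩ := traceField_eight Φ hΦ x
  have hmem : x (zetaOf 8 K) - (x (zetaOf 8 K))⁻¹ ∈ traceField Φ' := by
    rw [← heq, htr]; exact IntermediateField.mem_adjoin_simple_self ℚ _
  exact sq_ne_neg_of_mem_traceField_twenty Φ' hΦ' (k := 2) two_pos (not_isSquare_of_lt (t := 3) (by norm_num) (by norm_num)) hmem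
    (by rw [hsq]; norm_num)

/-- **`Y_8 ⟂ Y_{24}`** (`ℚ(√−2) ≠ ℚ(√−6)`; `12` is not a square). [cite: GalleseGoodsonLombardo2024, §3 Thm. 3.0 (last statement), §3.2 Lemma 12, §3.4]
[cite: MilneCM2006, Ch. I §1 Prop. 1.18 (c) and §3 Prop. 3.13] -/
theorem orthogonal_eight_twentyFour [IsCyclotomicExtension {8} ℚ K] [IsCyclotomicExtension {24} ℚ K']
    (hΦ : ∀ σ : K →+* ℂ, σ ∈ Φ.1 ↔ 2 * (expOf 8 K σ).val < 8) (hA : IsCMTypeRealisation Φ A ι θ)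
    (hΦ' : ∀ σ : K' →+* ℂ, σ ∈ Φ'.1 ↔ 2 * (expOf 24 K' σ).val < 24) (hA' : IsCMTypeRealisation Φ' A' ι' θ') :
    (∀ u : A ⟶ A', u = 0) ∧ (∀ v : A' ⟶ A, v = 0) ∧
      ¬ AbelianVariety.IsIsogenous A A' ∧ ¬ AbelianVariety.IsIsogenous A' A := by
  refine hA.orthogonal_of_traceField_ne hA' fun heq => ?_
  obtain ⟨x⟩ := (inferInstance : Nonempty (K →+* ℂ))
  obtain ⟨htr, hsq, -⟩ := traceField_eight Φ hΦ x
  have hmem : x (zetaOf 8 K) - (x (zetaOf 8 K))⁻¹ ∈ traceField Φ' := by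
    rw [← heq, htr]; exact IntermediateField.mem_adjoin_simple_self ℚ _
  exact sq_ne_neg_of_mem_traceField_twentyFour Φ' hΦ' (k := 2) two_pos (not_isSquare_of_lt (t := 3) (by norm_num) (by norm_num)) hmem
    (by rw [hsq]; norm_num)

/-- **`Y_{20} ⟂ Y_{24}`** (`ℚ(√−5) ≠ ℚ(√−6)`: `K*(Φ_{20}) ∋ x r`, `(x r)² = −5`; `30` is not a square).
[cite: GalleseGoodsonLombardo2024, §3 Thm. 3.0 (last statement) and §3.4] [cite: MilneCM2006, Ch. I §1 Prop. 1.18 (c) and §3 Prop. 3.13] -/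
theorem orthogonal_twenty_twentyFour [IsCyclotomicExtension {20} ℚ K] [IsCyclotomicExtension {24} ℚ K']
    (hΦ : ∀ σ : K →+* ℂ, σ ∈ Φ.1 ↔ 2 * (expOf 20 K σ).val < 20) (hA : IsCMTypeRealisation Φ A ι θ)
    (hΦ' : ∀ σ : K' →+* ℂ, σ ∈ Φ'.1 ↔ 2 * (expOf 24 K' σ).val < 24) (hA' : IsCMTypeRealisation Φ' A' ι' θ') :
    (∀ u : A ⟶ A', u = 0) ∧ (∀ v : A' ⟶ A, v = 0) ∧
      ¬ AbelianVariety.IsIsogenous A A' ∧ ¬ AbelianVariety.IsIsogenous A' A := by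
  refine hA.orthogonal_of_traceField_ne hA' fun heq => ?_
  obtain ⟨x⟩ := (inferInstance : Nonempty (K →+* ℂ))
  obtain ⟨htr, hsq, -, -⟩ := traceField_twenty Φ hΦ x
  have hmem : x (zetaOf 20 K + zetaOf 20 K ^ 3 + zetaOf 20 K ^ 7 + zetaOf 20 K ^ 9) ∈ traceField Φ' := by
    rw [← heq, htr]; exact IntermediateField.mem_adjoin_simple_self ℚ _
  exact sq_ne_neg_of_mem_traceField_twentyFour Φ' hΦ' (k := 5) (by norm_num)
    (not_isSquare_of_lt (t := 5) (by norm_num) (by norm_num)) hmem (by rw [hsq]; norm_num)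

/-- **`X_d ⟂ Y_{24}` for odd `d` with `3 ∣ d`** — in particular **`X_3 ⟂ Y_{24}`** (`√−3 ∈ K*(Φ_d)`, `√−3 ∉ ℚ(√−6)`: `18` is not a square).
[cite: GalleseGoodsonLombardo2024, §3 Thm. 3.0 (last statement) and §3.4] [cite: MilneCM2006, Ch. I §1 Prop. 1.18 (c) and §3 Prop. 3.13] -/
theorem orthogonal_odd_twentyFour_of_three_dvd [IsCyclotomicExtension {d} ℚ K] [IsCyclotomicExtension {24} ℚ K'] (hd : Odd d)
    (h3 : 3 ∣ d) (hΦ : ∀ σ : K →+* ℂ, σ ∈ Φ.1 ↔ 2 * (expOf d K σ).val < d) (hA : IsCMTypeRealisation Φ A ι θ)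
    (hΦ' : ∀ σ : K' →+* ℂ, σ ∈ Φ'.1 ↔ 2 * (expOf 24 K' σ).val < 24) (hA' : IsCMTypeRealisation Φ' A' ι' θ') :
    (∀ u : A ⟶ A', u = 0) ∧ (∀ v : A' ⟶ A, v = 0) ∧
      ¬ AbelianVariety.IsIsogenous A A' ∧ ¬ AbelianVariety.IsIsogenous A' A := by
  refine hA.orthogonal_of_traceField_ne hA' fun heq => ?_
  obtain ⟨u, hu, hu2⟩ := exists_sq_eq_neg_three_mem_traceField_odd hd h3 Φ hΦ
  rw [heq] at hu
  exact sq_ne_neg_of_mem_traceField_twentyFour Φ' hΦ' (k := 3) (by norm_num)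
    (not_isSquare_of_lt (t := 4) (by norm_num) (by norm_num)) hu (by rw [hu2]; norm_num)

/-- **`X_{2n} ⟂ Y_{24}` for odd `n ≥ 3` with `3 ∣ n`** — in particular **`X_6 ⟂ Y_{24}`**.
[cite: GalleseGoodsonLombardo2024, §3 Thm. 3.0 (4) and (last statement), §3.4] [cite: MilneCM2006, Ch. I §1 Prop. 1.18 (c) and §3 Prop. 3.13] -/
theorem orthogonal_twiceOdd_twentyFour_of_three_dvd [IsCyclotomicExtension {24} ℚ K'] (hn : Odd n) (h3n : 3 ≤ n) (h3 : 3 ∣ n)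
    (hΨ : ∀ σ : L →+* ℂ, σ ∈ Ψ.1 ↔ 2 * (expOf (2 * n) L σ).val < 2 * n) (hB : IsCMTypeRealisation Ψ B ιB θB)
    (hΦ' : ∀ σ : K' →+* ℂ, σ ∈ Φ'.1 ↔ 2 * (expOf 24 K' σ).val < 24) (hA' : IsCMTypeRealisation Φ' A' ι' θ') :
    (∀ u : B ⟶ A', u = 0) ∧ (∀ v : A' ⟶ B, v = 0) ∧
      ¬ AbelianVariety.IsIsogenous B A' ∧ ¬ AbelianVariety.IsIsogenous A' B := by
  refine hB.orthogonal_of_traceField_ne hA' fun heq => ?_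
  obtain ⟨u, hu, hu2⟩ := exists_sq_eq_neg_three_mem_traceField_twiceOdd hn h3n h3 Ψ hΨ
  rw [heq] at hu
  exact sq_ne_neg_of_mem_traceField_twentyFour Φ' hΦ' (k := 3) (by norm_num)
    (not_isSquare_of_lt (t := 4) (by norm_num) (by norm_num)) hu (by rw [hu2]; norm_num)

/-- **`X_{2n} ⟂ Y_{24}` for odd `n ≥ 3` with `φ(2n) ≠ 2`** (i.e. `n ≥ 5`; reflex degrees `φ(2n) ≠ 2 = [ℚ(√−6) : ℚ]`).
[cite: GalleseGoodsonLombardo2024, §3 Thm. 3.0 (4) and (last statement), §3.4] [cite: MilneCM2006, Ch. I §1 Prop. 1.18 (c)] -/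
theorem orthogonal_twiceOdd_twentyFour_of_totient_ne_two [IsCyclotomicExtension {24} ℚ K'] (hn : Odd n) (h3n : 3 ≤ n)
    (hφ : Nat.totient (2 * n) ≠ 2) (hΨ : ∀ σ : L →+* ℂ, σ ∈ Ψ.1 ↔ 2 * (expOf (2 * n) L σ).val < 2 * n)
    (hB : IsCMTypeRealisation Ψ B ιB θB) (hΦ' : ∀ σ : K' →+* ℂ, σ ∈ Φ'.1 ↔ 2 * (expOf 24 K' σ).val < 24)
    (hA' : IsCMTypeRealisation Φ' A' ι' θ') :
    (∀ u : B ⟶ A', u = 0) ∧ (∀ v : A' ⟶ B, v = 0) ∧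
      ¬ AbelianVariety.IsIsogenous B A' ∧ ¬ AbelianVariety.IsIsogenous A' B := by
  obtain ⟨x⟩ := (inferInstance : Nonempty (K' →+* ℂ))
  obtain ⟨-, -, hfr, -⟩ := traceField_twentyFour Φ' hΦ' x
  haveI : NeZero n := ⟨by omega⟩
  refine hB.orthogonal_of_finrank_traceField_ne hA' ?_
  rw [finrank_traceField_twiceOdd hn h3n Ψ hΨ, hfr]
  exact hφ

/-- **`X_d ⟂ Y_{60}` for odd `d ≥ 3` with `φ(d) ≠ 4`** — in particular **`X_3 ⟂ Y_{60}`** (reflex degrees `φ(d) ≠ 4 = [F_{60} : ℚ]`).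
[cite: GalleseGoodsonLombardo2024, §3 Thm. 3.0 (last statement) and §3.4 (`F_{60}`)] [cite: MilneCM2006, Ch. I §1 Prop. 1.18 (c)] -/
theorem orthogonal_odd_sixty_of_totient_ne_four [IsCyclotomicExtension {d} ℚ K] [IsCyclotomicExtension {60} ℚ K'] (hd : Odd d)
    (hφ : Nat.totient d ≠ 4) (hΦ : ∀ σ : K →+* ℂ, σ ∈ Φ.1 ↔ 2 * (expOf d K σ).val < d) (hA : IsCMTypeRealisation Φ A ι θ)
    (hΦ' : ∀ σ : K' →+* ℂ, σ ∈ Φ'.1 ↔ 2 * (expOf 60 K' σ).val < 60) (hA' : IsCMTypeRealisation Φ' A' ι' θ') :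
    (∀ u : A ⟶ A', u = 0) ∧ (∀ v : A' ⟶ A, v = 0) ∧
      ¬ AbelianVariety.IsIsogenous A A' ∧ ¬ AbelianVariety.IsIsogenous A' A := by
  obtain ⟨x⟩ := (inferInstance : Nonempty (K' →+* ℂ))
  obtain ⟨-, -, hfr, -⟩ := traceField_sixty Φ' hΦ' x
  refine hA.orthogonal_of_finrank_traceField_ne hA' ?_
  rw [finrank_traceField_odd hd Φ hΦ, hfr]
  exact hφ

/-- **`X_{2n} ⟂ Y_{60}` for odd `n ≥ 3` with `φ(2n) ≠ 4`** (all odd `n ≥ 3` except `n = 5`) — in particular **`X_6 ⟂ Y_{60}`**.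
[cite: GalleseGoodsonLombardo2024, §3 Thm. 3.0 (4) and (last statement), §3.4 (`F_{60}`)] [cite: MilneCM2006, Ch. I §1 Prop. 1.18 (c)] -/
theorem orthogonal_twiceOdd_sixty_of_totient_ne_four [IsCyclotomicExtension {60} ℚ K'] (hn : Odd n) (h3n : 3 ≤ n)
    (hφ : Nat.totient (2 * n) ≠ 4) (hΨ : ∀ σ : L →+* ℂ, σ ∈ Ψ.1 ↔ 2 * (expOf (2 * n) L σ).val < 2 * n)
    (hB : IsCMTypeRealisation Ψ B ιB θB) (hΦ' : ∀ σ : K' →+* ℂ, σ ∈ Φ'.1 ↔ 2 * (expOf 60 K' σ).val < 60)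
    (hA' : IsCMTypeRealisation Φ' A' ι' θ') :
    (∀ u : B ⟶ A', u = 0) ∧ (∀ v : A' ⟶ B, v = 0) ∧
      ¬ AbelianVariety.IsIsogenous B A' ∧ ¬ AbelianVariety.IsIsogenous A' B := by
  obtain ⟨x⟩ := (inferInstance : Nonempty (K' →+* ℂ))
  obtain ⟨-, -, hfr, -⟩ := traceField_sixty Φ' hΦ' x
  haveI : NeZero n := ⟨by omega⟩
  refine hB.orthogonal_of_finrank_traceField_ne hA' ?_
  rw [finrank_traceField_twiceOdd hn h3n Ψ hΨ, hfr]
  exact hφ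

/-- **The level-`3`, `6` instances: `X_3 ⟂ Y_{24}`, `X_3 ⟂ Y_{60}`** (`φ(3) = 2 ≠ 4`), for all realisations.
[cite: GalleseGoodsonLombardo2024, §3 Thm. 3.0 (last statement)] [cite: MilneCM2006, Ch. I §3 Prop. 3.13] -/
theorem orthogonal_three_twentyFour_and_sixty [IsCyclotomicExtension {3} ℚ K] (hΦ : ∀ σ : K →+* ℂ, σ ∈ Φ.1 ↔ 2 * (expOf 3 K σ).val < 3)
    (hA : IsCMTypeRealisation Φ A ι θ) :
    (∀ {K' : Type} [Field K'] [NumberField K'] [IsCyclotomicExtension {24} ℚ K'] {Φ' : CMType K'} {A' : AbelianVariety ℂ}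
        {ι' : 𝓞 K' →+* End A'} {θ' : K' →+* Module.End ℂ (complexBetti A'.X 1)},
        (∀ σ : K' →+* ℂ, σ ∈ Φ'.1 ↔ 2 * (expOf 24 K' σ).val < 24) → IsCMTypeRealisation Φ' A' ι' θ' →
          (∀ u : A ⟶ A', u = 0) ∧ (∀ v : A' ⟶ A, v = 0) ∧ ¬ AbelianVariety.IsIsogenous A A' ∧ ¬ AbelianVariety.IsIsogenous A' A) ∧
    (∀ {K' : Type} [Field K'] [NumberField K'] [IsCyclotomicExtension {60} ℚ K'] {Φ' : CMType K'} {A' : AbelianVariety ℂ}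
        {ι' : 𝓞 K' →+* End A'} {θ' : K' →+* Module.End ℂ (complexBetti A'.X 1)},
        (∀ σ : K' →+* ℂ, σ ∈ Φ'.1 ↔ 2 * (expOf 60 K' σ).val < 60) → IsCMTypeRealisation Φ' A' ι' θ' →
          (∀ u : A ⟶ A', u = 0) ∧ (∀ v : A' ⟶ A, v = 0) ∧ ¬ AbelianVariety.IsIsogenous A A' ∧ ¬ AbelianVariety.IsIsogenous A' A) := by
  haveI : NeZero (3 : ℕ) := ⟨by norm_num⟩
  exact ⟨fun hΦ' hA' => orthogonal_odd_twentyFour_of_three_dvd (by decide) (dvd_refl 3) hΦ hA hΦ' hA',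
    fun hΦ' hA' => orthogonal_odd_sixty_of_totient_ne_four (by decide) (by decide +kernel) hΦ hA hΦ' hA'⟩

end Orthogonal

end HyperellipticJacobian

end Literature.AlgebraicGeometry.ComplexMultiplication

end
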